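import Mathlib.Combinatorics.Additive.AP.Three.Behrend
import Mathlib.Analysis.SpecialFunctions.Pow.Asymptotics
import Mathlib.Data.Finset.Sort
import Literature.Computability.AlgebraicComplexity.TensorRestrictionRank

/-!
# `OrbitHarmonicsHosts.TruncatedPolynomialVacuity` — helper: `ω(ℂ) = 2` makes `⟨N,N,N⟩` a
# restriction of truncated polynomial multiplication `T_M`, `M ≤ N^{2+ε}`

Route `MatrixMultiplication/OrbitHarmonicsHosts`, support item `stmt-MatrixMultiplication-5457`,
direction (←) of the vacuity equivalence.  `T_M(k,i,j) = [i+j=k]` on `Fin M`.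

* `truncPoly_restrictsTo_unitTensor`: a 3-AP-free set `{e_0,…,e_{r-1}} ⊂ ℕ` with `2 e_x < M`
  gives `T_M ≥ ⟨r⟩` — read the `x^{2e_a}`-coefficient of `x^{e_b} · x^{e_c}`: it is
  `[e_b + e_c = 2 e_a] = [a = b = c]` (Salem–Spencer / Coppersmith–Winograd §6 trick).
* `rpow_le_rothNumberNat`: Behrend's bound (Mathlib `Behrend.roth_lower_bound`,
  `N e^{-4√log N} ≤ roth(N)`) in power form: `L^{1-η} ≤ roth(L)` for `L ≥ L₀(η)`.
* `truncPoly_hosts_of_omega_eq_two`: if `ω(ℂ) = 2` then for every `ε > 0` there are `N ≥ 2` and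
  `M ≤ N^{2+ε}` with `T_M ≥ ⟨N,N,N⟩`: `R(⟨N,N,N⟩) ≤ C N^{2+ε/4}`
  (`exists_tensorRank_matMulTensor_le_rpow`), `⟨N,N,N⟩ ≤ ⟨R(⟨N,N,N⟩)⟩`
  (`tensorRestrictsTo_unitTensor_of_tensorRank_le`), and with `M = ⌊N^{2+ε}⌋`, `L = ⌈M/2⌉`,
  `roth(L) ≥ L^{1-η} ≥ (N^{2+ε}/4)^{1-η} ≥ N^{2+7ε/8}/4 ≥ C N^{2+ε/4}` for `N` large
  (`η = ε/(8(2+ε))`).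
-/

-- the tree's namespace `Summit.MatrixMultiplication.MatrixMultiplication.…` repeats a component by design
set_option linter.dupNamespace false

noncomputable section

namespace Summit.MatrixMultiplication.MatrixMultiplication.Theorems

open scoped BigOperators
open Filter
open Literature.Computability.AlgebraicComplexity hiding MatrixMultiplication

/-- **Salem–Spencer embedding**: if `e : Fin r → ℕ` is injective with 3-AP-free image and
`2·e(x) < M`, then the unit tensor `⟨r⟩` is a restriction of `T_M` (`A = 𝟙_{2e_a}`, `B = 𝟙_{e_b}`,
`C = 𝟙_{e_c}`: the `x^{2e_a}`-coefficient of `x^{e_b} x^{e_c}` is `[a = b = c]`).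
(Coppersmith–Winograd 1990, §6.) [folklore] -/
theorem truncPoly_restrictsTo_unitTensor {M r : ℕ} (e : Fin r → ℕ) (he : Function.Injective e)
    (hfree : ThreeAPFree (Set.range e)) (hlt : ∀ x, 2 * e x < M) :
    TensorRestrictsTo (fun k i j : Fin M => if (i : ℕ) + j = k then (1 : ℂ) else 0)
      (unitTensor ℂ r) := by
  refine ⟨fun a k => if (k : ℕ) = 2 * e a then 1 else 0, fun b i => if (i : ℕ) = e b then 1 else 0,
    fun c j => if (j : ℕ) = e c then 1 else 0, fun a b c => ?_⟩
  have ha : 2 * e a < M := hlt a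
  have hb : e b < M := by have := hlt b; omega
  have hc : e c < M := by have := hlt c; omega
  rw [Finset.sum_eq_single (⟨2 * e a, ha⟩ : Fin M) (fun k _ hk => by
        have hk' : (k : ℕ) ≠ 2 * e a := fun h => hk (Fin.ext h)
        simp [hk']) (by simp),
    Finset.sum_eq_single (⟨e b, hb⟩ : Fin M) (fun i _ hi => by
        have hi' : (i : ℕ) ≠ e b := fun h => hi (Fin.ext h)
        simp [hi']) (by simp),
    Finset.sum_eq_single (⟨e c, hc⟩ : Fin M) (fun j _ hj => by
        have hj' : (j : ℕ) ≠ e c := fun h => hj (Fin.ext h)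
        simp [hj']) (by simp)]
  by_cases h : a = b ∧ b = c
  · obtain ⟨rfl, rfl⟩ := h
    have h2 : e a + e a = 2 * e a := by ring
    simp [h2]
  · have hne : ¬ (e b + e c = 2 * e a) := by
      intro hsum
      have h1 : e b = e a :=
        hfree (Set.mem_range_self b) (Set.mem_range_self a) (Set.mem_range_self c) (by omega)
      have h2 : e b = e c := by omega
      exact h ⟨(he h1).symm, he h2⟩
    simp [h, hne]

/-- **Behrend's lower bound in power form**: for every `η > 0` there is `L₀` with
`L^{1-η} ≤ roth(L)` for all `L ≥ L₀` (from Mathlib's `Behrend.roth_lower_bound`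
`L · e^{-4√(log L)} ≤ roth(L)`, since `4√(log L) ≤ η log L` once `log L ≥ 16/η²`).
(Behrend 1946.) [folklore] -/
theorem rpow_le_rothNumberNat {η : ℝ} (hη : 0 < η) :
    ∃ L₀ : ℕ, ∀ L : ℕ, L₀ ≤ L → (L : ℝ) ^ (1 - η) ≤ rothNumberNat L := by
  refine ⟨⌈Real.exp (16 / η ^ 2)⌉₊ + 1, fun L hL => ?_⟩
  have hL1 : (1 : ℝ) ≤ L := by exact_mod_cast (by omega : 1 ≤ L)
  have hLpos : (0 : ℝ) < L := by linarith
  have hlog0 : 0 ≤ Real.log L := Real.log_nonneg hL1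
  have hlog : 16 / η ^ 2 ≤ Real.log L := by
    rw [Real.le_log_iff_exp_le hLpos]
    calc Real.exp (16 / η ^ 2) ≤ ⌈Real.exp (16 / η ^ 2)⌉₊ := Nat.le_ceil _
      _ ≤ L := by exact_mod_cast (by omega : ⌈Real.exp (16 / η ^ 2)⌉₊ ≤ L)
  have hy : 4 / η ≤ Real.sqrt (Real.log L) := by
    rw [Real.le_sqrt' (by positivity)]
    calc (4 / η) ^ 2 = 16 / η ^ 2 := by ring
      _ ≤ Real.log L := hlog
  have hkey : 4 * Real.sqrt (Real.log L) ≤ η * Real.log L := by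
    have hs0 : 0 ≤ Real.sqrt (Real.log L) := Real.sqrt_nonneg _
    calc 4 * Real.sqrt (Real.log L) = (η * (4 / η)) * Real.sqrt (Real.log L) := by
          field_simp
      _ ≤ (η * Real.sqrt (Real.log L)) * Real.sqrt (Real.log L) := by gcongr
      _ = η * Real.log L := by rw [mul_assoc, Real.mul_self_sqrt hlog0]
  refine le_trans ?_ Behrend.roth_lower_bound
  rw [Real.rpow_def_of_pos hLpos,
    show Real.log L * (1 - η) = Real.log L + -(η * Real.log L) by ring,
    Real.exp_add, Real.exp_log hLpos]
  gcongr
  linarith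

/-- **(←) of the vacuity equivalence**: if `ω(ℂ) = 2` then for every `ε > 0` there are `N ≥ 2`
and `M ≤ N^{2+ε}` such that `⟨N,N,N⟩` is a restriction of the truncated polynomial
multiplication tensor `T_M` (`⟨N,N,N⟩ ≤ ⟨R(⟨N,N,N⟩)⟩ ≤ T_M` through a Behrend set).
[folklore] -/
theorem truncPoly_hosts_of_omega_eq_two (hω : omega ℂ = 2) {ε : ℝ} (hε : 0 < ε) :
    ∃ N M : ℕ, 2 ≤ N ∧ (M : ℝ) ≤ (N : ℝ) ^ (2 + ε) ∧
      TensorRestrictsTo (fun k i j : Fin M => if (i : ℕ) + j = k then (1 : ℂ) else 0)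
        (matMulTensor ℂ N N N) := by
  -- (a) the rank bound from `ω = 2`
  obtain ⟨C, hC, hCbound⟩ :=
    exists_tensorRank_matMulTensor_le_rpow ℂ (δ := ε / 4) (by positivity)
  rw [hω] at hCbound
  -- (b) Behrend in power form with exponent loss `η`, `(2+ε) η = ε/8`
  set η : ℝ := ε / (8 * (2 + ε)) with hη
  have hη0 : 0 < η := by positivity
  have hηε : (2 + ε) * η = ε / 8 := by
    rw [hη]
    field_simp
  have hη1 : η < 1 := by nlinarith
  obtain ⟨L₀, hL₀⟩ := rpow_le_rothNumberNat hη0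
  -- (c) choose `N` large
  have hev : ∀ᶠ N : ℕ in atTop, 2 ≤ N ∧ L₀ ≤ N ∧ 4 * C ≤ (N : ℝ) ^ (5 * ε / 8) := by
    refine (eventually_ge_atTop 2).and ((eventually_ge_atTop L₀).and ?_)
    have ht : Tendsto (fun N : ℕ => (N : ℝ) ^ (5 * ε / 8)) atTop atTop :=
      (tendsto_rpow_atTop (by positivity)).comp tendsto_natCast_atTop_atTop
    exact ht.eventually_ge_atTop (4 * C)
  obtain ⟨N, hN2, hNL, hNC⟩ := hev.exists
  have hN0 : (0 : ℝ) < N := by exact_mod_cast (by omega : 0 < N)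
  have hN1 : (1 : ℝ) ≤ N := by exact_mod_cast (by omega : 1 ≤ N)
  set X : ℝ := (N : ℝ) ^ (2 + ε) with hX
  have hX0 : 0 ≤ X := by positivity
  set M : ℕ := ⌊X⌋₊ with hM
  refine ⟨N, M, hN2, Nat.floor_le hX0, ?_⟩
  -- sizes: `N² ≤ M`, `X ≤ 2M ≤ 4L`
  have hXN : ((N ^ 2 : ℕ) : ℝ) ≤ X := by
    rw [hX, Nat.cast_pow, ← Real.rpow_natCast]
    exact Real.rpow_le_rpow_of_exponent_le hN1 (by push_cast; linarith)
  have hMN : N ^ 2 ≤ M := Nat.le_floor hXN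
  have hsq : 2 * N ≤ N ^ 2 := by nlinarith
  have h4 : 4 ≤ N ^ 2 := by nlinarith
  have h2N : 2 * N ≤ M := hsq.trans hMN
  have h4M : 4 ≤ M := h4.trans hMN
  set L : ℕ := (M + 1) / 2 with hL
  have hLL₀ : L₀ ≤ L := by omega
  have hXM : X ≤ 2 * (M : ℝ) := by
    have h1 : X < M + 1 := Nat.lt_floor_add_one X
    have h2 : (4 : ℝ) ≤ M := by exact_mod_cast h4M
    linarith
  have hXL : X / 4 ≤ (L : ℝ) := by
    have : (M : ℝ) ≤ 2 * L := by exact_mod_cast (by omega : M ≤ 2 * L)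
    linarith
  -- (d) the chain `R(⟨N,N,N⟩) ≤ roth(L)`
  have key : (tensorRank (matMulTensor ℂ N N N) : ℝ) ≤ rothNumberNat L := by
    calc (tensorRank (matMulTensor ℂ N N N) : ℝ) ≤ C * (N : ℝ) ^ (2 + ε / 4) :=
          hCbound N (by omega)
      _ = (4 * C) * (N : ℝ) ^ (2 + ε / 4) / 4 := by ring
      _ ≤ (N : ℝ) ^ (5 * ε / 8) * (N : ℝ) ^ (2 + ε / 4) / 4 := by gcongr
      _ = (N : ℝ) ^ (2 + 7 * ε / 8) / 4 := by
          rw [← Real.rpow_add hN0]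
          congr 1
          ring
      _ ≤ (X / 4) ^ (1 - η) := by
          rw [Real.div_rpow hX0 (by norm_num), hX, ← Real.rpow_mul hN0.le,
            show (2 + ε) * (1 - η) = 2 + 7 * ε / 8 by linear_combination (-1 : ℝ) * hηε]
          apply div_le_div_of_nonneg_left (by positivity) (by positivity)
          calc (4 : ℝ) ^ (1 - η) ≤ (4 : ℝ) ^ (1 : ℝ) :=
                Real.rpow_le_rpow_of_exponent_le (by norm_num) (by linarith)
            _ = 4 := Real.rpow_one 4
      _ ≤ (L : ℝ) ^ (1 - η) := Real.rpow_le_rpow (by positivity) hXL (by linarith)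
      _ ≤ rothNumberNat L := hL₀ L hLL₀
  have hrL : tensorRank (matMulTensor ℂ N N N) ≤ rothNumberNat L := by exact_mod_cast key
  -- (e) the 3-AP-free set and the embedding
  obtain ⟨t, htL, htcard, hfree⟩ := rothNumberNat_spec L
  obtain ⟨u, hut, hucard⟩ := Finset.exists_subset_card_eq (hrL.trans htcard.ge)
  have hemem : ∀ x : Fin (tensorRank (matMulTensor ℂ N N N)), u.orderEmbOfFin hucard x ∈ u :=
    fun x => Finset.orderEmbOfFin_mem u hucard x
  have hfree' : ThreeAPFree (Set.range fun x => u.orderEmbOfFin hucard x) :=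
    hfree.mono (by
      rintro _ ⟨x, rfl⟩
      exact hut (hemem x))
  have hlt : ∀ x, 2 * u.orderEmbOfFin hucard x < M := fun x => by
    have h1 : u.orderEmbOfFin hucard x < L := Finset.mem_range.1 (htL (hut (hemem x)))
    omega
  exact (truncPoly_restrictsTo_unitTensor (fun x => u.orderEmbOfFin hucard x)
    (u.orderEmbOfFin hucard).injective hfree' hlt).trans
    (tensorRestrictsTo_unitTensor_of_tensorRank_le _ le_rfl)

end Summit.MatrixMultiplication.MatrixMultiplication.Theorems

end
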